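import Summits.BirchSwinnertonDyer.BirchSwinnertonDyer.Theorems.AdditiveKolyvaginRoadBottomRankOneAdditiveOfPrimitive
import Summits.BirchSwinnertonDyer.BirchSwinnertonDyer.Theorems.AdditiveKolyvaginRoadLevelSystemsBottom
import Summits.BirchSwinnertonDyer.BirchSwinnertonDyer.Theorems.AdditiveKolyvaginRoadTwoPrimeJump
import Summits.BirchSwinnertonDyer.BirchSwinnertonDyer.Theorems.AdditiveKolyvaginRoadKolyvaginPrimitiveOfLevelSystems
import HarnessLib

/-!
# Route `AdditiveKolyvaginRoad`, crux `BottomRankOneAdditive` (item stmt-BirchSwinnertonDyer-21397, BOT′):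
# THE BOTTOM CRUX IS INSIDE THE CONE OF THE LEVEL-SYSTEMS CRUX KS′, BY NAME, at the pinned witness `n = 1` —
# `PublishedInputsAdditiveKoly → PublishedDualityInputsAdditiveKoly → LevelKolyvaginSystemsAdditive → BottomRankOneAdditive`
# (cell `pub/bsd-wall`, width seat `bsd-wall-akr-p3-w2` g0; `--supports stmt-BirchSwinnertonDyer-21397`, helper)

THEOREMS ONLY (no definition, no named fact, no `sorry`); every antecedent is a HYPOTHESIS; BSD is not proved by any of this.

THE POINT. akr-p2x's «the bottom is inside the level system» (`kolyvaginPrimitive_of_levelSystem_of_rankOne`, p567709)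
concludes, at a ♯ additive frame with `#Sel_p(E/K) = p`, a non-zero `c_1(n)` for SOME `n ∈ Λ` — the conclusion of the
primitivity crux r2, NOT the bottom crux's pinned `c(1) ≠ 0`; its (J2) binder (two-prime Poitou–Tate jump) is since
DISCHARGED from DUAL.2 by akr-p1's `twoPrimeJump_of_poitouTate` (`…TwoPrimeJump`, landed). The sibling file
`…BottomRankOneAdditiveOfPrimitive` (width seat akr-p3-w3) closes the gap `∃ n ⟶ n = 1` by the Kolyvagin–McCallum structure
theorem at `M_∞ = 0` (PUB conjunct 9: `exists_kolyvaginClass_one_ne_zero_of_exists_kolyvaginClass_ne_zero`), and states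
`PUB → DUAL → KS′ → BOT′` only modulo an explicit BOT′-free-glue HYPOTHESIS (`bottomRankOneAdditive_of_levelSystems_of_botFreeGlue`).
This file DISCHARGES that hypothesis by composing the three landed pieces directly at each frame (complex conjugation
`c ≠ 1`, the unique `𝔽_p`-structure on `H¹(K, E[p])`, KS′'s level system, J2 from Poitou–Tate, the two-prime bottom, then
Kolyvagin–McCallum):

* `bottomRankOneAdditive_of_levelSystems : PublishedInputsAdditiveKoly → PublishedDualityInputsAdditiveKoly →
  LevelKolyvaginSystemsAdditive → BottomRankOneAdditive`.
* `kolyvaginPrimitiveAdditive_of_levelSystems_via_bottom : PublishedInputsAdditiveKoly →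
  PublishedDualityInputsAdditiveKoly → LevelKolyvaginSystemsAdditive → KolyvaginPrimitiveAdditive` — the BOT′-FREE E-side
  composition as the two-line corollary «item 21266 (`kolyvaginPrimitiveOfLevelSystemsAdditive_proof`) ∘ the previous
  bullet»; an independent path to the statement the akr-p1 lineage proves through skeleton v10 (distinct name, no collision).

So, for the route's bookkeeping (planner's business, recorded here): granted PUB and DUAL, `KS′ ⟹ BOT′` and `KS′ ⟹ KPA′`;
the bottom crux carries no open mathematics beyond KS′.

References (locators only): [cite: WZhang2014, Thm. 4.3, Lemma 5.3, Thm. 7.2, §9, Remark 5 and Thm. 10.2]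
[cite: McCallumLMS1991, §5 Cor. 5.6] [cite: BertoliniDarmon2005, Thm. 3.2] [cite: MilneADT2006, Ch. I Thm. 4.10].
-/

-- single-conjunct summit: `Summit.BirchSwinnertonDyer.BirchSwinnertonDyer.…` repeats the name by design
set_option linter.dupNamespace false

set_option autoImplicit false

noncomputable section

open scoped Classical

namespace Summit.BirchSwinnertonDyer.BirchSwinnertonDyer.Theorems.AdditiveKoly

open WeierstrassCurve NumberField Field
  Literature.NumberTheory.EllipticCurves Literature.NumberTheory.EllipticCurves.ModularForms
  Literature.NumberTheory.EllipticCurves.Rank1Residual Literature.NumberTheory.GaloisRepresentations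
  Summit.BirchSwinnertonDyer.Rank1Residual Summit.BirchSwinnertonDyer.Rank1Residual.X11b
  Summit.BirchSwinnertonDyer.Rank1Residual.X11b.Three
  Summit.BirchSwinnertonDyer.BirchSwinnertonDyer.Theses.AdditiveKolyvaginRoad

/-- **`BottomRankOneAdditive ⟸ PublishedInputsAdditiveKoly ∧ PublishedDualityInputsAdditiveKoly ∧
LevelKolyvaginSystemsAdditive`: the bottom crux is INSIDE THE CONE OF THE LEVEL-SYSTEMS CRUX KS′, by name, at the pinned
witness `n = 1`.** At a ♯ additive frame with `#Sel_p(E/K) = p`: complex conjugation `c ≠ 1`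
(`exists_algEquiv_ne_one_of_isImaginaryQuadratic`), the unique `𝔽_p`-structure on `H¹(K, E[p])`, a level Kolyvagin
system from KS′, the two-prime jump (J2) from the Poitou–Tate fact DUAL.2 (`twoPrimeJump_of_poitouTate`, akr-p1), the
two-prime bottom of the level system (`kolyvaginPrimitive_of_levelSystem_of_rankOne`, akr-p2x: SOME `c_1(n) ≠ 0`), and
Kolyvagin–McCallum at `M_∞ = 0` (`exists_kolyvaginClass_one_ne_zero_of_exists_kolyvaginClass_ne_zero`, akr-p3-w3: then
`c(1) ≠ 0`). No glue hypothesis (compare `bottomRankOneAdditive_of_levelSystems_of_botFreeGlue`). CONDITIONAL on the three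
antecedents; nothing is booked.
[cite: WZhang2014, Thm. 4.3, Lemma 5.3, Thm. 7.2, §9, Remark 5 and Thm. 10.2] [cite: McCallumLMS1991, §5 Cor. 5.6] -/
theorem bottomRankOneAdditive_of_levelSystems
    (hPub : PublishedInputsAdditiveKoly) (hDual : PublishedDualityInputsAdditiveKoly)
    (hKS : LevelKolyvaginSystemsAdditive) : BottomRankOneAdditive := by
  intro W _ _ _ p _ K _ _ Dt β ι hp5 hadd hs hsp htwo htam hr hK hodd hlt hH hL hβ hc hSel
  obtain ⟨hGZ, hKo, -, -, hmod, -, -, -, hMc, -⟩ := hPub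
  -- non-CM from a multiplicative prime
  obtain ⟨ℓ₁, ℓ₂, hℓ₁, hℓ₂, hne, hm₁, hm₂⟩ := htwo
  have hCM : ¬ W.HasCM := not_hasCM_of_hasMultiplicativeReductionAtPrime' W hm₁
  -- complex conjugation and the unique `ZMod p`-module structure on `H¹(K, E[p])`
  obtain ⟨c, hc1⟩ := exists_algEquiv_ne_one_of_isImaginaryQuadratic K hK
  letI : Module (ZMod p) (Vp W K p) :=
    AddCommGroup.zmodModule (fun x ↦ by
      have h := zsmul_discreteH1_torsion ((p ^ 1 : ℕ) : ℤ) x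
      rw [← natCast_zsmul]
      convert h using 2
      push_cast
      ring)
  -- a level Kolyvagin system at the frame (KS′), the two-prime jump (J2) from Poitou–Tate (DUAL.2)
  obtain ⟨S⟩ := hKS W p K Dt β ι hp5 hadd hs hsp ⟨ℓ₁, ℓ₂, hℓ₁, hℓ₂, hne, hm₁, hm₂⟩ htam hr hK hodd hlt hH hL hβ hc c hc1
  have hJ2 := twoPrimeJump_of_poitouTate W K p c hp5 hK hc1 (hDual.2 K)
  -- the two-prime bottom of the level system: SOME `c_1(n) ≠ 0`, `n ∈ Λ`
  obtain ⟨n, dn, hn, hdn⟩ :=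
    kolyvaginPrimitive_of_levelSystem_of_rankOne W K p c Dt β ι hp5 hadd hs hK hH hc1 hJ2 S hSel
  -- Kolyvagin–McCallum at the bottom
  exact exists_kolyvaginClass_one_ne_zero_of_exists_kolyvaginClass_ne_zero W p K Dt β ι (hGZ _ W K) (hKo _ W K) hmod hMc
    hp5 hs hCM hr hK hlt hH hL hβ hSel ⟨n, dn, hn, hdn⟩

/-- **The BOT′-free E-side composition, as a corollary**: `PublishedInputsAdditiveKoly → PublishedDualityInputsAdditiveKoly →
LevelKolyvaginSystemsAdditive → KolyvaginPrimitiveAdditive` — item 21266 (`kolyvaginPrimitiveOfLevelSystemsAdditive_proof`: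
`PUB → DUAL → KS′ → BOT′ → KPA′`, akr-p1 g4) with its BOT′ antecedent SUPPLIED by `bottomRankOneAdditive_of_levelSystems`.
An independent two-line path to the statement the akr-p1 lineage proves through skeleton v10 (stub J2 in place of BOT);
distinct name. CONDITIONAL on the three antecedents; nothing is booked. [cite: WZhang2014, §9 proof of Thm. 9.1, Thm. 9.2] -/
theorem kolyvaginPrimitiveAdditive_of_levelSystems_via_bottom
    (hPub : PublishedInputsAdditiveKoly) (hDual : PublishedDualityInputsAdditiveKoly)
    (hKS : LevelKolyvaginSystemsAdditive) : KolyvaginPrimitiveAdditive :=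
  kolyvaginPrimitiveOfLevelSystemsAdditive_proof hPub hDual hKS (bottomRankOneAdditive_of_levelSystems hPub hDual hKS)

end Summit.BirchSwinnertonDyer.BirchSwinnertonDyer.Theorems.AdditiveKoly

end
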